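import Literature.MathematicalPhysics.QuantumLattice.LatticeScalarField
import HarnessLib

/-!
# The Riemann-sum tail lemma for smeared lattice fields

Discharge of the named fact `finLatticeField_tail_tendsto` of `LatticeScalarField.lean`: the
smeared field over `box d (L δ)` differs from the full lattice pairing `ρ δᵈ ∑_{x ∈ ℤᵈ} φₓ f(δx)`
(the lattice inner product `∑ δᵈ f(x) φ(x)` of Glimm–Jaffe 1987, §9.5, (9.5.5), used throughout
the lattice approximation of §9.6) by at most `ε`, eventually as `δ → 0⁺` with `δ L(δ) → ∞`,
uniformly over configurations with `|φₓ| ≤ C`.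

## Proof (elementary Riemann-sum tail estimate, made explicit)

* Schwartz decay in product form `∏ᵢ (1 + |yᵢ|)² |f(y)| ≤ M`
  (`SchwartzMap.one_add_le_sup_seminorm_apply` with `k = 2d`, and `|yᵢ| ≤ ‖y‖`), hence
  `δᵈ |φₓ f(δx)| ≤ C M W_δ(x)` with `W_δ(x) = ∏ᵢ w_δ(xᵢ)`, `w_δ(n) = δ/(1 + δ|n|)²`
  (both weights are written out explicitly below).
* One-dimensional telescoping `δ/(1+δ(k+1))² ≤ (1+δk)⁻¹ − (1+δ(k+1))⁻¹` gives
  `∑_{L<|n|} w_δ(n) ≤ 2/(1+δL)` and `∑_n w_δ(n) ≤ δ + 2` over any finite set of integers.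
* Union bound over the coordinate leaving the box and `∑_{x ∈ box} ∏ᵢ = ∏ᵢ ∑`
  (`Finset.prod_univ_sum`): `∑_{x ∈ box N \ box L} W_δ(x) ≤ d · 2 (1+δL)⁻¹ (δ+2)ᵈ`.
* Summability of `x ↦ φₓ f(δx)`, `∑_{box N} → ∑'` as `N → ∞`, passage to the limit in the
  uniform tail bound, and `|ρ| C M d 2·3ᵈ/(1 + δ L(δ)) ≤ ε` eventually since `δ L(δ) → ∞`.

Reference: J. Glimm, A. Jaffe, *Quantum Physics: a functional integral point of view*, 2nd ed.,
Springer 1987, §9.5 ((9.5.5)), §9.6. All auxiliary statements are private proof devices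
([folklore]); no definitions and no new named facts are introduced (D-0026).
-/

open scoped SchwartzMap
open Filter Topology Finset

namespace Literature.MathematicalPhysics.QuantumLattice

open Literature.Probability.LatticeModels

variable {d : ℕ}

/-! ### One-dimensional weights `w_δ(n) = δ / (1 + δ|n|)²` and the telescoping bound -/

/-- `w_δ(n) = δ / (1 + δ|n|)² ≥ 0` for `δ ≥ 0`. [folklore] -/
private theorem wt_nonneg {δ : ℝ} (hδ : 0 ≤ δ) (n : ℤ) : 0 ≤ δ / (1 + δ * |(n : ℝ)|) ^ 2 := by
  positivity

/-- Telescoping step: `δ/(1+δ(k+1))² ≤ (1+δk)⁻¹ − (1+δ(k+1))⁻¹` for `δ, k ≥ 0`. [folklore] -/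
private theorem telescope_step {δ k : ℝ} (hδ : 0 ≤ δ) (hk : 0 ≤ k) :
    δ / (1 + δ * (k + 1)) ^ 2 ≤ (1 + δ * k)⁻¹ - (1 + δ * (k + 1))⁻¹ := by
  have ha : 0 < 1 + δ * k := by positivity
  have hb : 0 < 1 + δ * (k + 1) := by positivity
  rw [inv_sub_inv ha.ne' hb.ne', show 1 + δ * (k + 1) - (1 + δ * k) = δ by ring, sq]
  exact div_le_div_of_nonneg_left hδ (mul_pos ha hb)
    (mul_le_mul_of_nonneg_right (by nlinarith) hb.le)

/-- Telescoped one-sided tail: `∑_{j<m} δ/(1+δ(L+j+1))² ≤ (1+δL)⁻¹ − (1+δ(L+m))⁻¹`. [folklore] -/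
private theorem sum_range_telescope_le {δ : ℝ} (hδ : 0 ≤ δ) (L m : ℕ) :
    ∑ j ∈ range m, δ / (1 + δ * ((L : ℝ) + j + 1)) ^ 2 ≤
      (1 + δ * L)⁻¹ - (1 + δ * ((L : ℝ) + m))⁻¹ := by
  induction m with
  | zero => simp
  | succ m ih =>
    rw [sum_range_succ, Nat.cast_add, Nat.cast_one, ← add_assoc (L : ℝ) m 1]
    have h := telescope_step hδ (k := (L : ℝ) + m) (by positivity)
    linarith

/-- One-dimensional two-sided tail bound: over any finite set of integers with `L < |n|`,
`∑ w_δ(n) ≤ 2/(1+δL)`. [folklore] -/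
private theorem sum_wt_le_of_lt_abs {δ : ℝ} (hδ : 0 ≤ δ) (L : ℕ) (t : Finset ℤ)
    (ht : ∀ n ∈ t, (L : ℤ) < |n|) :
    ∑ n ∈ t, δ / (1 + δ * |(n : ℝ)|) ^ 2 ≤ 2 * (1 + δ * L)⁻¹ := by
  classical
  obtain ⟨m, hm⟩ : ∃ m : ℕ, ∀ n ∈ t, n.natAbs ≤ m :=
    ⟨t.sup Int.natAbs, fun n hn => Finset.le_sup (f := Int.natAbs) hn⟩
  set eP : ℕ → ℤ := fun j => (L : ℤ) + j + 1 with heP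
  set eN : ℕ → ℤ := fun j => -((L : ℤ) + j + 1) with heN
  have hsub : t ⊆ (range m).image eP ∪ (range m).image eN := by
    intro n hn
    have h1 : (L : ℤ) < |n| := ht n hn
    have h2 : n.natAbs ≤ m := hm n hn
    have h3 : ((n.natAbs : ℕ) : ℤ) = |n| := Int.natCast_natAbs n
    rw [mem_union, Finset.mem_image, Finset.mem_image]
    rcases le_total 0 n with hn0 | hn0
    · rw [abs_of_nonneg hn0] at h1 h3
      exact Or.inl ⟨n.natAbs - L - 1, Finset.mem_range.2 (by omega),
        by simp only [heP]; omega⟩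
    · rw [abs_of_nonpos hn0] at h1 h3
      exact Or.inr ⟨n.natAbs - L - 1, Finset.mem_range.2 (by omega),
        by simp only [heN]; omega⟩
  have hwtP : ∀ j ∈ range m,
      δ / (1 + δ * |(eP j : ℝ)|) ^ 2 = δ / (1 + δ * ((L : ℝ) + j + 1)) ^ 2 :=
    fun j _ => by simp only [heP]; push_cast; rw [abs_of_nonneg (by positivity)]
  have hwtN : ∀ j ∈ range m,
      δ / (1 + δ * |(eN j : ℝ)|) ^ 2 = δ / (1 + δ * ((L : ℝ) + j + 1)) ^ 2 :=
    fun j _ => by simp only [heN]; push_cast; rw [abs_neg, abs_of_nonneg (by positivity)]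
  have hinjP : Set.InjOn eP (range m) := fun a _ b _ h => by simp only [heP] at h; omega
  have hinjN : Set.InjOn eN (range m) := fun a _ b _ h => by simp only [heN] at h; omega
  have htel := sum_range_telescope_le hδ L m
  have hrest : 0 ≤ (1 + δ * ((L : ℝ) + m))⁻¹ := by positivity
  calc ∑ n ∈ t, δ / (1 + δ * |(n : ℝ)|) ^ 2
      ≤ ∑ n ∈ (range m).image eP ∪ (range m).image eN, δ / (1 + δ * |(n : ℝ)|) ^ 2 :=
        sum_le_sum_of_subset_of_nonneg hsub fun n _ _ => wt_nonneg hδ n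
    _ ≤ ∑ n ∈ (range m).image eP, δ / (1 + δ * |(n : ℝ)|) ^ 2 +
          ∑ n ∈ (range m).image eN, δ / (1 + δ * |(n : ℝ)|) ^ 2 := by
        rw [← sum_union_inter]
        exact le_add_of_nonneg_right (sum_nonneg fun n _ => wt_nonneg hδ n)
    _ = ∑ j ∈ range m, δ / (1 + δ * ((L : ℝ) + j + 1)) ^ 2 +
          ∑ j ∈ range m, δ / (1 + δ * ((L : ℝ) + j + 1)) ^ 2 := by
        rw [sum_image hinjP, sum_image hinjN, sum_congr rfl hwtP, sum_congr rfl hwtN]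
    _ ≤ (1 + δ * L)⁻¹ + (1 + δ * L)⁻¹ := by linarith
    _ = 2 * (1 + δ * L)⁻¹ := by ring

/-- One-dimensional full sum: `∑_{n ∈ t} w_δ(n) ≤ δ + 2` over any finite set of integers.
[folklore] -/
private theorem sum_wt_le {δ : ℝ} (hδ : 0 ≤ δ) (t : Finset ℤ) :
    ∑ n ∈ t, δ / (1 + δ * |(n : ℝ)|) ^ 2 ≤ δ + 2 := by
  classical
  rw [← sum_filter_add_sum_filter_not t (fun n : ℤ => n = 0)]
  have h0 : ∑ n ∈ t.filter (fun n : ℤ => n = 0), δ / (1 + δ * |(n : ℝ)|) ^ 2 ≤ δ := by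
    calc ∑ n ∈ t.filter (fun n : ℤ => n = 0), δ / (1 + δ * |(n : ℝ)|) ^ 2
        ≤ ∑ n ∈ ({0} : Finset ℤ), δ / (1 + δ * |(n : ℝ)|) ^ 2 :=
          sum_le_sum_of_subset_of_nonneg
            (fun n hn => Finset.mem_singleton.2 (Finset.mem_filter.1 hn).2)
            fun n _ _ => wt_nonneg hδ n
      _ = δ := by simp
  have h1 : ∑ n ∈ t.filter (fun n : ℤ => ¬n = 0), δ / (1 + δ * |(n : ℝ)|) ^ 2 ≤
      2 * (1 + δ * ((0 : ℕ) : ℝ))⁻¹ :=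
    sum_wt_le_of_lt_abs hδ 0 _ fun n hn => by simpa using (Finset.mem_filter.1 hn).2
  have h2 : (2 : ℝ) * (1 + δ * ((0 : ℕ) : ℝ))⁻¹ = 2 := by simp
  linarith

/-! ### The product weight `W_δ(x) = ∏ᵢ w_δ(xᵢ)` on `ℤᵈ` and box sums -/

/-- `W_δ(x) = ∏ᵢ w_δ(xᵢ) ≥ 0` for `δ ≥ 0`. [folklore] -/
private theorem wtd_nonneg {δ : ℝ} (hδ : 0 ≤ δ) (x : Site d) :
    0 ≤ ∏ i, δ / (1 + δ * |(x i : ℝ)|) ^ 2 :=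
  prod_nonneg fun i _ => wt_nonneg hδ (x i)

/-- Full box sum of the product weight: `∑_{x ∈ box N} W_δ(x) ≤ (δ+2)ᵈ` (factorisation
`Finset.prod_univ_sum`). [folklore] -/
private theorem sum_box_wtd_le {δ : ℝ} (hδ : 0 ≤ δ) (N : ℕ) :
    ∑ x ∈ box d N, ∏ i, δ / (1 + δ * |(x i : ℝ)|) ^ 2 ≤ (δ + 2) ^ d := by
  have h : ∑ x ∈ box d N, ∏ i, δ / (1 + δ * |(x i : ℝ)|) ^ 2 =
      ∏ _i : Fin d, ∑ n ∈ Icc (-(N : ℤ)) N, δ / (1 + δ * |(n : ℝ)|) ^ 2 := by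
    rw [box]
    exact (Finset.prod_univ_sum (fun _ : Fin d => Icc (-(N : ℤ)) N)
      (fun _ n => δ / (1 + δ * |(n : ℝ)|) ^ 2)).symm
  rw [h, Finset.prod_const, card_univ, Fintype.card_fin]
  exact pow_le_pow_left₀ (sum_nonneg fun n _ => wt_nonneg hδ n) (sum_wt_le hδ _) d

/-- Every finite subset of `ℤᵈ` lies in some box. [folklore] -/
private theorem exists_subset_box (u : Finset (Site d)) : ∃ N : ℕ, u ⊆ box d N := by
  classical
  refine ⟨u.sup fun x => univ.sup fun i => (x i).natAbs, fun x hx => ?_⟩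
  rw [mem_box]
  intro i
  have h1 : (x i).natAbs ≤ univ.sup (fun i => (x i).natAbs) :=
    Finset.le_sup (f := fun i => (x i).natAbs) (mem_univ i)
  have h2 : univ.sup (fun i => (x i).natAbs) ≤ u.sup fun x => univ.sup fun i => (x i).natAbs :=
    Finset.le_sup (f := fun x : Site d => univ.sup fun i => (x i).natAbs) hx
  omega

/-- Tail box sum of the product weight, uniformly in the outer box:
`∑_{x ∈ box N \ box L} W_δ(x) ≤ d · 2(1+δL)⁻¹ (δ+2)ᵈ` (union bound over the coordinate leaving
`box L`, then factorisation). [folklore] -/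
private theorem sum_box_sdiff_wtd_le {δ : ℝ} (hδ : 0 ≤ δ) (L N : ℕ) :
    ∑ x ∈ box d N \ box d L, ∏ i, δ / (1 + δ * |(x i : ℝ)|) ^ 2 ≤
      d * (2 * (1 + δ * L)⁻¹ * (δ + 2) ^ d) := by
  classical
  -- indicator of "coordinate `i` leaves `box L`"
  set I : Fin d → Site d → ℝ := fun i x => if (L : ℤ) < |x i| then 1 else 0 with hI
  have hI_nonneg : ∀ i x, 0 ≤ I i x := fun i x => by simp only [hI]; split_ifs <;> norm_num
  -- (a) outside `box L` at least one indicator fires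
  have ha : ∀ x ∈ box d N \ box d L, ∏ k, δ / (1 + δ * |(x k : ℝ)|) ^ 2 ≤
      ∑ i, I i x * ∏ k, δ / (1 + δ * |(x k : ℝ)|) ^ 2 := by
    intro x hx
    rw [Finset.mem_sdiff, mem_box, mem_box] at hx
    obtain ⟨i, hi⟩ := not_forall.1 hx.2
    have hi' : (L : ℤ) < |x i| := not_le.1 fun h => hi (abs_le.1 h)
    calc ∏ k, δ / (1 + δ * |(x k : ℝ)|) ^ 2 = I i x * ∏ k, δ / (1 + δ * |(x k : ℝ)|) ^ 2 := by
          simp [hI, hi']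
      _ ≤ ∑ j, I j x * ∏ k, δ / (1 + δ * |(x k : ℝ)|) ^ 2 :=
        single_le_sum (f := fun j => I j x * ∏ k, δ / (1 + δ * |(x k : ℝ)|) ^ 2)
          (fun j _ => mul_nonneg (hI_nonneg j x) (wtd_nonneg hδ x)) (mem_univ i)
  -- (c) the bound for a fixed coordinate
  have hc : ∀ i : Fin d, ∑ x ∈ box d N, I i x * ∏ k, δ / (1 + δ * |(x k : ℝ)|) ^ 2 ≤
      2 * (1 + δ * L)⁻¹ * (δ + 2) ^ d := by
    intro i
    set v : Fin d → ℤ → ℝ :=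
      fun j n => if j = i ∧ ¬(L : ℤ) < |n| then 0 else δ / (1 + δ * |(n : ℝ)|) ^ 2 with hv
    have hv_nonneg : ∀ j n, 0 ≤ v j n := fun j n => by
      simp only [hv]; split_ifs; exacts [le_rfl, wt_nonneg hδ n]
    have hprod : ∀ x : Site d,
        I i x * ∏ k, δ / (1 + δ * |(x k : ℝ)|) ^ 2 = ∏ j, v j (x j) := by
      intro x
      by_cases h : (L : ℤ) < |x i|
      · have hI1 : I i x = 1 := by simp [hI, h]
        rw [hI1, one_mul]
        refine Finset.prod_congr rfl fun j _ => ?_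
        simp only [hv]
        rw [if_neg]
        rintro ⟨rfl, h'⟩
        exact h' h
      · have hI0 : I i x = 0 := by simp [hI, h]
        rw [hI0, zero_mul]
        exact (prod_eq_zero (mem_univ i) (by simp [hv, h])).symm
    have hfac : ∑ x ∈ box d N, I i x * ∏ k, δ / (1 + δ * |(x k : ℝ)|) ^ 2 =
        ∏ j, ∑ n ∈ Icc (-(N : ℤ)) N, v j n := by
      simp only [hprod, box]
      exact (Finset.prod_univ_sum (fun _ : Fin d => Icc (-(N : ℤ)) N) v).symm
    have hbi : ∑ n ∈ Icc (-(N : ℤ)) N, v i n ≤ 2 * (1 + δ * L)⁻¹ := by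
      have he : ∑ n ∈ Icc (-(N : ℤ)) N, v i n =
          ∑ n ∈ (Icc (-(N : ℤ)) N).filter (fun n => (L : ℤ) < |n|),
            δ / (1 + δ * |(n : ℝ)|) ^ 2 := by
        rw [sum_filter]
        refine sum_congr rfl fun n _ => ?_
        by_cases hn : (L : ℤ) < |n| <;> simp [hv, hn]
      rw [he]
      exact sum_wt_le_of_lt_abs hδ L _ fun n hn => (Finset.mem_filter.1 hn).2
    have hbj : ∀ j, j ≠ i → ∑ n ∈ Icc (-(N : ℤ)) N, v j n ≤ δ + 2 := by
      intro j hj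
      have he : ∀ n, v j n = δ / (1 + δ * |(n : ℝ)|) ^ 2 := fun n => by simp [hv, hj]
      simp only [he]
      exact sum_wt_le hδ _
    rw [hfac]
    set b : Fin d → ℝ := fun j => if j = i then 2 * (1 + δ * L)⁻¹ else δ + 2 with hb
    have hcb : ∀ j, ∑ n ∈ Icc (-(N : ℤ)) N, v j n ≤ b j := by
      intro j
      simp only [hb]
      split_ifs with hj
      exacts [hj ▸ hbi, hbj j hj]
    calc ∏ j, ∑ n ∈ Icc (-(N : ℤ)) N, v j n ≤ ∏ j, b j :=
          Finset.prod_le_prod (fun j _ => sum_nonneg fun n _ => hv_nonneg j n) fun j _ => hcb j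
      _ = b i * ∏ j ∈ univ.erase i, b j := (mul_prod_erase univ b (mem_univ i)).symm
      _ = 2 * (1 + δ * L)⁻¹ * (δ + 2) ^ #(univ.erase i) := by
          have h1 : b i = 2 * (1 + δ * L)⁻¹ := by simp [hb]
          have h2 : ∏ j ∈ univ.erase i, b j = ∏ _j ∈ univ.erase i, (δ + 2) :=
            Finset.prod_congr rfl fun j hj => by simp [hb, ne_of_mem_erase hj]
          rw [h1, h2, Finset.prod_const]
      _ ≤ 2 * (1 + δ * L)⁻¹ * (δ + 2) ^ d := by
          apply mul_le_mul_of_nonneg_left _ (by positivity)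
          exact pow_le_pow_right₀ (by linarith)
            ((Finset.card_le_univ _).trans_eq (Fintype.card_fin d))
  -- (b) assemble
  calc ∑ x ∈ box d N \ box d L, ∏ k, δ / (1 + δ * |(x k : ℝ)|) ^ 2
      ≤ ∑ x ∈ box d N \ box d L, ∑ i, I i x * ∏ k, δ / (1 + δ * |(x k : ℝ)|) ^ 2 :=
        sum_le_sum ha
    _ ≤ ∑ x ∈ box d N, ∑ i, I i x * ∏ k, δ / (1 + δ * |(x k : ℝ)|) ^ 2 :=
        sum_le_sum_of_subset_of_nonneg Finset.sdiff_subset fun x _ _ =>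
          sum_nonneg fun i _ => mul_nonneg (hI_nonneg i x) (wtd_nonneg hδ x)
    _ = ∑ i, ∑ x ∈ box d N, I i x * ∏ k, δ / (1 + δ * |(x k : ℝ)|) ^ 2 := Finset.sum_comm
    _ ≤ ∑ _i : Fin d, 2 * (1 + δ * L)⁻¹ * (δ + 2) ^ d := sum_le_sum fun i _ => hc i
    _ = d * (2 * (1 + δ * L)⁻¹ * (δ + 2) ^ d) := by
        rw [Finset.sum_const, card_univ, Fintype.card_fin, nsmul_eq_mul]

/-! ### Schwartz decay in product form and the pointwise bound -/

/-- Product-form decay of a Schwartz function on `ℝᵈ`: `∏ᵢ (1+|yᵢ|)² |f(y)| ≤ M`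
(from `(1+‖y‖)^{2d} |f(y)| ≤ M` and `|yᵢ| ≤ ‖y‖`). [folklore] -/
private theorem schwartz_prod_decay (f : 𝓢(EuclideanSpace ℝ (Fin d), ℝ)) :
    ∃ M : ℝ, 0 ≤ M ∧ ∀ y : EuclideanSpace ℝ (Fin d), (∏ i, (1 + |y i|) ^ 2) * |f y| ≤ M := by
  obtain ⟨M, hM⟩ : ∃ M : ℝ, ∀ y : EuclideanSpace ℝ (Fin d),
      (1 + ‖y‖) ^ (2 * d) * |f y| ≤ M := by
    refine ⟨2 ^ (2 * d) *
      (Finset.Iic (2 * d, 0)).sup (fun m => SchwartzMap.seminorm ℝ m.1 m.2) f, fun y => ?_⟩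
    have h := SchwartzMap.one_add_le_sup_seminorm_apply (𝕜 := ℝ) (m := (2 * d, 0))
      (k := 2 * d) (n := 0) le_rfl le_rfl f y
    rwa [norm_iteratedFDeriv_zero, Real.norm_eq_abs] at h
  refine ⟨M, le_trans (by positivity) (hM 0), fun y => le_trans ?_ (hM y)⟩
  apply mul_le_mul_of_nonneg_right _ (abs_nonneg _)
  calc ∏ i, (1 + |y i|) ^ 2 ≤ ∏ _i : Fin d, (1 + ‖y‖) ^ 2 := by
        refine Finset.prod_le_prod (fun i _ => by positivity) fun i _ => ?_
        have hyi : |y i| ≤ ‖y‖ := by simpa using PiLp.norm_apply_le y i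
        exact pow_le_pow_left₀ (by positivity) (by linarith) 2
    _ = (1 + ‖y‖) ^ (2 * d) := by
        rw [Finset.prod_const, card_univ, Fintype.card_fin, ← pow_mul]

/-- The pointwise bound `δᵈ |φₓ f(δx)| ≤ C M W_δ(x)` for `|φₓ| ≤ C`. [folklore] -/
private theorem pow_mul_abs_le_wtd {δ C M : ℝ} (hδ : 0 < δ)
    {f : 𝓢(EuclideanSpace ℝ (Fin d), ℝ)}
    (hM : ∀ y : EuclideanSpace ℝ (Fin d), (∏ i, (1 + |y i|) ^ 2) * |f y| ≤ M)
    {φ : Site d → ℝ} (hφ : ∀ x, |φ x| ≤ C) (x : Site d) :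
    δ ^ d * |φ x * f (δ • siteToE x)| ≤ C * M * ∏ i, δ / (1 + δ * |(x i : ℝ)|) ^ 2 := by
  have hC : 0 ≤ C := (abs_nonneg _).trans (hφ x)
  set P : ℝ := ∏ i, (1 + δ * |(x i : ℝ)|) ^ 2 with hP
  have hP0 : 0 < P := by positivity
  have hwtd : ∏ i, δ / (1 + δ * |(x i : ℝ)|) ^ 2 = δ ^ d / P := by
    rw [hP, prod_div_distrib, Finset.prod_const, card_univ, Fintype.card_fin]
  have hfy : P * |f (δ • siteToE x)| ≤ M := by
    have h := hM (δ • siteToE x)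
    have hcoord : ∀ i, |(δ • siteToE x) i| = δ * |(x i : ℝ)| := fun i => by
      rw [PiLp.smul_apply, siteToE_apply, smul_eq_mul, abs_mul, abs_of_pos hδ]
    simp only [hcoord] at h
    exact h
  have hf_le : |f (δ • siteToE x)| ≤ M / P := by
    rw [le_div_iff₀ hP0, mul_comm]
    exact hfy
  calc δ ^ d * |φ x * f (δ • siteToE x)| = δ ^ d * (|φ x| * |f (δ • siteToE x)|) := by
        rw [abs_mul]
    _ ≤ δ ^ d * (C * (M / P)) := by
        apply mul_le_mul_of_nonneg_left _ (by positivity)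
        exact mul_le_mul (hφ x) hf_le (abs_nonneg _) hC
    _ = C * M * (δ ^ d / P) := by ring
    _ = C * M * ∏ i, δ / (1 + δ * |(x i : ℝ)|) ^ 2 := by rw [hwtd]

/-! ### The tail lemma -/

/-- **Discharge of `finLatticeField_tail_tendsto`** (Riemann-sum tail estimate for the lattice
pairing `δᵈ ∑ₓ f(δx) φₓ` of Glimm–Jaffe 1987, §9.5, (9.5.5), §9.6): for a Schwartz test
function `f`, a field-strength factor `ρ`, a bound `C` and half-sides `L(δ)` with
`δ L(δ) → ∞` as `δ → 0⁺`, eventually in `δ` and uniformly over configurations with `|φₓ| ≤ C`,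
`|ρ δᵈ ∑'ₓ φₓ f(δx) − finLatticeField (box d (L δ)) δ ρ φ f| ≤ ε`. The estimate itself is
elementary (Schwartz decay, a telescoping one-dimensional bound and the product structure of
boxes; see the module docstring). [cite: GlimmJaffe1987, §9.5–9.6] -/
theorem finLatticeField_tail_tendsto_holds : finLatticeField_tail_tendsto (d := d) := by
  intro f ρ C L hL ε hε
  obtain ⟨M, hM0, hM⟩ := schwartz_prod_decay f
  set K : ℝ := |ρ| * (|C| * M * (d * (2 * 3 ^ d))) with hK
  have h1 : ∀ᶠ δ in 𝓝[>] (0 : ℝ), δ ∈ Set.Ioc (0 : ℝ) 1 := Ioc_mem_nhdsGT one_pos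
  have h2 : ∀ᶠ δ in 𝓝[>] (0 : ℝ), K / ε ≤ δ * L δ := hL.eventually_ge_atTop (K / ε)
  filter_upwards [h1, h2] with δ hδ1 hKδ φ hφ
  obtain ⟨hδ, hδ1⟩ := hδ1
  have hC : 0 ≤ C := (abs_nonneg _).trans (hφ 0)
  have hCabs : |C| = C := abs_of_nonneg hC
  -- the summand, the weight, and summability
  set g : Site d → ℝ := fun x => φ x * f (δ • siteToE x) with hg
  set W : Site d → ℝ := fun x => ∏ i, δ / (1 + δ * |(x i : ℝ)|) ^ 2
  have hpt : ∀ x, δ ^ d * |g x| ≤ C * M * W x := fun x => pow_mul_abs_le_wtd hδ hM hφ x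
  have hg_fin : ∀ u : Finset (Site d), δ ^ d * ∑ x ∈ u, |g x| ≤ C * M * (δ + 2) ^ d := by
    intro u
    obtain ⟨N, hN⟩ := exists_subset_box u
    calc δ ^ d * ∑ x ∈ u, |g x| ≤ δ ^ d * ∑ x ∈ box d N, |g x| :=
          mul_le_mul_of_nonneg_left
            (sum_le_sum_of_subset_of_nonneg hN fun x _ _ => abs_nonneg _) (by positivity)
      _ = ∑ x ∈ box d N, δ ^ d * |g x| := mul_sum _ _ _
      _ ≤ ∑ x ∈ box d N, C * M * W x := sum_le_sum fun x _ => hpt x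
      _ = C * M * ∑ x ∈ box d N, W x := (mul_sum _ _ _).symm
      _ ≤ C * M * (δ + 2) ^ d :=
          mul_le_mul_of_nonneg_left (sum_box_wtd_le hδ.le N) (mul_nonneg hC hM0)
  have hsum : Summable g := by
    refine Summable.of_norm (summable_of_sum_le (c := (δ ^ d)⁻¹ * (C * M * (δ + 2) ^ d))
      (fun x => norm_nonneg _) fun u => ?_)
    rw [le_inv_mul_iff₀ (pow_pos hδ d)]
    simpa only [Real.norm_eq_abs] using hg_fin u
  -- partial sums over boxes converge to the full lattice sum
  have htend : Tendsto (fun N : ℕ => ∑ x ∈ box d N, g x) atTop (𝓝 (∑' x, g x)) := by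
    have hbox : Tendsto (box d) atTop atTop := by
      refine tendsto_atTop_finset_of_monotone (box_mono d) fun x => ?_
      obtain ⟨N, hN⟩ := exists_subset_box ({x} : Finset (Site d))
      exact ⟨N, hN (mem_singleton_self x)⟩
    exact hsum.hasSum.comp hbox
  -- uniform tail bound on the partial sums, then pass to the limit
  have htail : ∀ N, L δ ≤ N → δ ^ d * |∑ x ∈ box d N, g x - ∑ x ∈ box d (L δ), g x| ≤
      C * M * (d * (2 * (1 + δ * L δ)⁻¹ * (δ + 2) ^ d)) := by
    intro N hN
    rw [← sum_sdiff_eq_sub (box_mono d hN)]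
    calc δ ^ d * |∑ x ∈ box d N \ box d (L δ), g x|
        ≤ δ ^ d * ∑ x ∈ box d N \ box d (L δ), |g x| :=
          mul_le_mul_of_nonneg_left (abs_sum_le_sum_abs _ _) (by positivity)
      _ = ∑ x ∈ box d N \ box d (L δ), δ ^ d * |g x| := mul_sum _ _ _
      _ ≤ ∑ x ∈ box d N \ box d (L δ), C * M * W x := sum_le_sum fun x _ => hpt x
      _ = C * M * ∑ x ∈ box d N \ box d (L δ), W x := (mul_sum _ _ _).symm
      _ ≤ C * M * (d * (2 * (1 + δ * L δ)⁻¹ * (δ + 2) ^ d)) :=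
          mul_le_mul_of_nonneg_left (sum_box_sdiff_wtd_le hδ.le (L δ) N) (mul_nonneg hC hM0)
  have hlim : δ ^ d * |∑' x, g x - ∑ x ∈ box d (L δ), g x| ≤
      C * M * (d * (2 * (1 + δ * L δ)⁻¹ * (δ + 2) ^ d)) := by
    have ht : Tendsto (fun N : ℕ => δ ^ d * |∑ x ∈ box d N, g x - ∑ x ∈ box d (L δ), g x|)
        atTop (𝓝 (δ ^ d * |∑' x, g x - ∑ x ∈ box d (L δ), g x|)) :=
      ((htend.sub_const _).abs).const_mul _
    exact le_of_tendsto ht (eventually_atTop.2 ⟨L δ, htail⟩)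
  -- rewrite the smeared field as `ρ δᵈ ∑_{box} g` and conclude
  have hfin : finLatticeField (box d (L δ)) δ ρ φ f = ρ * δ ^ d * ∑ x ∈ box d (L δ), g x := by
    rw [finLatticeField_apply, mul_sum]
    refine sum_congr rfl fun x _ => ?_
    simp only [hg]
    ring
  have hrw : ρ * δ ^ d * (∑' x, g x) - ρ * δ ^ d * ∑ x ∈ box d (L δ), g x =
      ρ * (δ ^ d * ((∑' x, g x) - ∑ x ∈ box d (L δ), g x)) := by ring
  rw [hfin, hrw, abs_mul, abs_mul, abs_of_pos (pow_pos hδ d)]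
  have hpos : 0 < 1 + δ * L δ := by positivity
  have h3 : (δ + 2) ^ d ≤ 3 ^ d := pow_le_pow_left₀ (by positivity) (by linarith) d
  have hCM : 0 ≤ C * M := mul_nonneg hC hM0
  calc |ρ| * (δ ^ d * |∑' x, g x - ∑ x ∈ box d (L δ), g x|)
      ≤ |ρ| * (C * M * (d * (2 * (1 + δ * L δ)⁻¹ * (δ + 2) ^ d))) :=
        mul_le_mul_of_nonneg_left hlim (abs_nonneg ρ)
    _ ≤ |ρ| * (C * M * (d * (2 * (1 + δ * L δ)⁻¹ * 3 ^ d))) := by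
        apply mul_le_mul_of_nonneg_left _ (abs_nonneg ρ)
        apply mul_le_mul_of_nonneg_left _ hCM
        apply mul_le_mul_of_nonneg_left _ (Nat.cast_nonneg d)
        exact mul_le_mul_of_nonneg_left h3 (by positivity)
    _ = K * (1 + δ * L δ)⁻¹ := by
        rw [hK, hCabs]
        ring
    _ ≤ ε := by
        rw [← div_eq_mul_inv, div_le_iff₀ hpos]
        have hK' : K ≤ ε * (δ * L δ) := (div_le_iff₀' hε).1 hKδ
        nlinarith

end Literature.MathematicalPhysics.QuantumLattice
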